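import Summits.MatrixMultiplication.OmegaCensus.SmallFormats.MatMul229GF3CoverCases
import Summits.MatrixMultiplication.OmegaCensus.SmallFormats.MatMul229GF3CoverRunsN
import Summits.MatrixMultiplication.OmegaCensus.SmallFormats.MatMul229GF3CoverRunsK0
import Summits.MatrixMultiplication.OmegaCensus.SmallFormats.MatMul229GF3CoverRunsK1
import Summits.MatrixMultiplication.OmegaCensus.SmallFormats.MatMul229GF3CoverRunsK2
import Summits.MatrixMultiplication.OmegaCensus.SmallFormats.MatMul229GF3CoverRunsK3
import Summits.MatrixMultiplication.OmegaCensus.SmallFormats.MatMul229GF3CoverRunsK4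
import Summits.MatrixMultiplication.OmegaCensus.SmallFormats.MatMul229GF3CoverRunsK5
import Summits.MatrixMultiplication.OmegaCensus.SmallFormats.MatMul229GF3CoverRunsK6
import Summits.MatrixMultiplication.OmegaCensus.SmallFormats.MatMul229GF3CoverRunsK7
import Summits.MatrixMultiplication.OmegaCensus.SmallFormats.MatMul229GF3NoM1
import Summits.MatrixMultiplication.OmegaCensus.SmallFormats.MatMul229GF3NoM2
import Summits.MatrixMultiplication.OmegaCensus.SmallFormats.MatMul227GF3Enumeration
import HarnessLib

/-!
# ω-census family (a): **`31 ≤ R_𝔽₃(⟨2,2,9⟩)`** — the `(9,30)` rung over `𝔽₃`, unconditional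

Cell `pub-omega` (unit `pub-omega-tensor`, gen 41), topic `Summits/MatrixMultiplication/OmegaCensus` (sub-folder
`SmallFormats`). Framing (verbatim): lottery ticket; floor = certified bounds/negative ranges. HONEST FRAMING: a census rung for the
SMALL format `⟨2,2,9⟩` over the field `𝔽₃` (one above the printed floor `30 = ⌈36·9/11⌉ = 3·9+3` of the `𝔽₃` ladder in this folder;
the Hopcroft–Kerr ceiling is `32`). Nothing here is a bound on `ω`.

Assembly of the census chain:
* the funnel at `(9,30)` (`Enum723.thirtyone_le_tensorRank_229_gf3_of_noLoadedPlane`, p729529, tensor g39): `31 ≤ R` unless some `30`-term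
  computation has `σ ≥ 14` rank-one X-forms with a load-`4` row plane and a load-`4` column plane (all plane loads `≤ 4`);
* the count vector of such a computation is admissible for the loaded-branch system `Cover930.Adm930` (clauses `cnt_clauses` with the half law
  plus one `C = 10`, digit cap `cnt_add_three_mul_le`);
* the COVER certificate (`Cover930.cover930_of_covers` with the kernel replays `runN`, `runK*`, `runG`, `runT`, `runD` of the LP-guided
  branch-and-bound tree — 57 + 1532 + 3 leaves, box-Farkas integer multipliers, kit j336026 of tensor g41): the count vector is a group image of
  `cnt M1` or `cnt M2`, hence (`inOrbit_of_cnt_eq`, `inOrbit_moveW`) the X-marginal is `InOrbit`-related to `M1` or `M2`;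
* the two kernel words of tensor g40: `NoM1.xMarginal_ne_M1` (p744825), `NoM2.xMarginal_ne_M2` (p739221) — neither is an X-marginal —
  transported along the orbit by `exists_xMarginal_eq_of_inOrbit`.
Main statements: `thirtyone_le_tensorRank_229_gf3`, `tensorRank_229_gf3_mem` (`R_𝔽₃(⟨2,2,9⟩) ∈ [31, 32]`).
-/

namespace Summit.MatrixMultiplication.OmegaCensus.SmallFormats.Cover930

open Finset Matrix Enum723 BoxCover
open Literature.Computability.AlgebraicComplexity
open Summit.MatrixMultiplication.OmegaCensus.RankOnePlaneCapGeneral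

set_option maxRecDepth 4000

/-! ## The kernel replays give the covering hypotheses -/

/-- Case `N` is covered (no solutions). -/
theorem coversN : Covers rowsN [] 40 lo0 hi3 := covers_of_chk (by decide) (by decide) runN

/-- Case `γ` is covered (no solutions). -/
theorem coversG : Covers rowsA [] 40 loG hiG := covers_of_chk (by decide) (by decide) runG

/-- Case `τ` is covered (no solutions). -/
theorem coversT : Covers rowsA [] 40 loT hiT := covers_of_chk (by decide) (by decide) runT

/-- Case `δ` is covered (no solutions). -/
theorem coversD : Covers rowsA [] 40 lo0 hiD := covers_of_chk (by decide) (by decide) runD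

/-- Case `κ` is covered (the 28 solutions `solsK`): the chunks `runK0 … runK25` assembled along the top of the branch-and-bound tree. -/
theorem coversK : Covers rowsA solsK 40 loK hi3 :=
    (covers_split 30 1 (by decide) (by decide) (covers_split 38 1 (by decide) (by decide) (covers_split 39 1 (by decide)
    (by decide) (covers_split 24 1 (by decide) (by decide) (covers_split 35 0 (by decide) (by decide) (covers_split 30
    0 (by decide) (by decide) (covers_of_chk (by decide) (by decide) runK0) (covers_split 33 1 (by decide) (by decide)
    (covers_of_chk (by decide) (by decide) runK1) (covers_of_chk (by decide) (by decide) runK2))) (covers_split 38 0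
    (by decide) (by decide) (covers_of_chk (by decide) (by decide) runK3) (covers_split 34 1 (by decide) (by decide)
    (covers_split 25 0 (by decide) (by decide) (covers_of_chk (by decide) (by decide) runK4) (covers_split 29 0 (by
    decide) (by decide) (covers_of_chk (by decide) (by decide) runK5) (covers_split 32 0 (by decide) (by decide)
    (covers_of_chk (by decide) (by decide) runK6) (covers_split 39 0 (by decide) (by decide) (covers_of_chk (by
    decide) (by decide) runK7) (covers_split 27 0 (by decide) (by decide) (covers_of_chk (by decide) (by decide)
    runK8) (covers_split 28 0 (by decide) (by decide) (covers_of_chk (by decide) (by decide) runK9) (covers_split 7 0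
    (by decide) (by decide) (covers_split 24 0 (by decide) (by decide) (covers_of_chk (by decide) (by decide) runK10)
    (covers_split 5 0 (by decide) (by decide) (covers_of_chk (by decide) (by decide) runK11) (covers_of_chk (by
    decide) (by decide) runK12))) (covers_split 4 0 (by decide) (by decide) (covers_of_chk (by decide) (by decide)
    runK13) (covers_of_chk (by decide) (by decide) runK14))))))))) (covers_of_chk (by decide) (by decide) runK15))))
    (covers_split 24 2 (by decide) (by decide) (covers_split 31 1 (by decide) (by decide) (covers_split 25 0 (by
    decide) (by decide) (covers_of_chk (by decide) (by decide) runK16) (covers_of_chk (by decide) (by decide) runK17))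
    (covers_of_chk (by decide) (by decide) runK18)) (covers_of_chk (by decide) (by decide) runK19))) (covers_of_chk
    (by decide) (by decide) runK20)) (covers_of_chk (by decide) (by decide) runK21)) (covers_split 26 0 (by decide)
    (by decide) (covers_of_chk (by decide) (by decide) runK22) (covers_split 24 1 (by decide) (by decide)
    (covers_split 37 1 (by decide) (by decide) (covers_of_chk (by decide) (by decide) runK23) (covers_of_chk (by
    decide) (by decide) runK24)) (covers_of_chk (by decide) (by decide) runK25))))

/-- **The cover theorem at `(9,30)`**: every admissible count vector of the loaded branch is a group image of `cnt M1` or `cnt M2`. -/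
theorem cover930 (c : ℕ → ℕ) (h : Adm930 c) : ∃ j, j < 2 ∧ ∃ w, WordOK w ∧ Eq40 c (actWS w (repv930 j)) :=
  cover930_of_covers coversN coversK coversG coversT coversD c h

/-! ## The two representatives -/

/-- The representatives: `M1` (tensor g40's `NoM1` literal) and `M2` (`NoM2` literal). -/
def REP930 (j : ℕ) : Fin 30 → Matrix (Fin 2) (Fin 2) (ZMod 3) :=
  if j = 0 then
    ![!![1, 0; 0, 1], !![0, 1; 1, 1], !![1, 1; 1, 2], !![0, 1; 1, 0], !![1, 1; 0, 1], !![1, 0; 2, 1], !![0, 1; 2, 0], !![1, 2; 2, 2], !![1, 0; 1, 2]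
     , !![1, 1; 1, 0], !![1, 0; 2, 2], !![0, 1; 2, 2], !![1, 1; 2, 1], !![1, 2; 1, 0], !![1, 0; 0, 0], !![0, 1; 0, 0], !![1, 1; 0, 0], !![1, 2; 0, 0]
     , !![0, 0; 1, 0], !![0, 0; 0, 1], !![0, 0; 1, 1], !![0, 0; 1, 2], !![1, 0; 1, 0], !![0, 1; 0, 1], !![1, 1; 1, 1], !![1, 2; 1, 2], !![1, 0; 2, 0]
     , !![0, 1; 0, 2], !![1, 1; 2, 2], !![1, 2; 2, 1]]
  else
    ![!![1, 0; 0, 1], !![0, 1; 1, 1], !![1, 2; 2, 0], !![0, 1; 1, 0], !![1, 0; 2, 1], !![0, 1; 1, 2], !![1, 2; 0, 2], !![0, 1; 2, 0], !![1, 2; 2, 2],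
      !![0, 1; 2, 1], !![1, 2; 0, 1], !![1, 0; 2, 2], !![0, 1; 2, 2], !![1, 0; 0, 2], !![1, 0; 0, 0], !![0, 1; 0, 0], !![1, 1; 0, 0], !![1, 2; 0, 0],
      !![0, 0; 1, 0], !![0, 0; 1, 1], !![0, 0; 1, 1], !![0, 0; 1, 2], !![1, 0; 1, 0], !![0, 1; 0, 1], !![0, 1; 0, 1], !![1, 2; 1, 2], !![1, 0; 2, 0],
      !![0, 1; 0, 2], !![1, 1; 2, 2], !![1, 2; 2, 1]]

/-- The representatives are nowhere zero and have the tabulated count vectors `rep930cL`. -/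
theorem REP930_facts : ∀ j, j < 2 → (∀ i, REP930 j i ≠ 0) ∧ Eq40 (cnt (REP930 j)) (repv930 j) := by
  unfold Eq40 repv930 cnt; decide +kernel

/-- Neither representative is an X-marginal (tensor g40's two kernel words). -/
theorem xMarginal_ne_REP930 (j : ℕ) (hj : j < 2) (β : BilinComp (mulBilin (ZMod 3) 2 2 9) (Fin 30)) : xMarginal β ≠ REP930 j := by
  interval_cases j
  · exact NoM1.xMarginal_ne_M1 β
  · exact NoM2.xMarginal_ne_M2 β

/-! ## The rung -/

/-- The count vector of a `30`-term computation in the loaded branch is admissible for `Adm930`. -/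
theorem adm930_cnt (β : BilinComp (mulBilin (ZMod 3) 2 2 9) (Fin 30))
    (hload : 14 ≤ ∑ a ∈ Finset.Ico 24 40, cnt (xMarginal β) a ∧ (∃ k, 32 ≤ k ∧ k < 36 ∧ load (cnt (xMarginal β)) k = 4) ∧
      (∃ k, 36 ≤ k ∧ k < 40 ∧ load (cnt (xMarginal β)) k = 4) ∧ ∀ k, 32 ≤ k → k < 40 → load (cnt (xMarginal β)) k ≤ 4) :
    Adm930 (cnt (xMarginal β)) := by
  classical
  have hr : 30 ≤ tensorRank (matMulTensor (ZMod 3) 2 2 9) := by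
    have h := (tensorRank_matMulTensor_22n_gf3_window 9 (by norm_num)).1
    have h' : max (3 * 9 + 2) ((36 * 9 + 10) / 11) = 30 := by norm_num
    omega
  have hm := xMarginal_ne_zero_of_le_tensorRank hr β
  obtain ⟨hJ, -, hQ, hL, ht⟩ := cnt_clauses (C := 10) (xMarginal β) hm (xCaps3_xMarginal β) fun X₀ hX₀ => by
    have h := invLineCapHalfPlus_xMarginal (n := 9) (by norm_num) β X₀ hX₀; omega
  obtain ⟨hσ, -, -, h4⟩ := hload
  refine ⟨fun k hk => ?_, fun a ha => by have := cnt_add_three_mul_le β a ha; omega, ht, hσ⟩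
  rw [cap930_eq k hk]
  by_cases h1 : k < 32
  · rw [if_pos h1]; have := hJ k h1; omega
  rw [if_neg h1]
  by_cases h2 : k < 40
  · rw [if_pos h2]; exact h4 k (by omega) h2
  rw [if_neg h2]
  by_cases h3 : k < 58
  · rw [if_pos h3]; have := hQ k (by omega) h3; omega
  · rw [if_neg h3]; exact hL k (by omega) hk

/-- **`31 ≤ R_𝔽₃(⟨2,2,9⟩)` — UNCONDITIONAL.** -/
theorem thirtyone_le_tensorRank_229_gf3 : 31 ≤ tensorRank (matMulTensor (ZMod 3) 2 2 9) := by
  classical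
  refine thirtyone_le_tensorRank_229_gf3_of_noLoadedPlane fun β hload => ?_
  obtain ⟨j, hj, w, hw, he⟩ := cover930 _ (adm930_cnt β hload)
  obtain ⟨hR0, hRc⟩ := REP930_facts j hj
  have hm : ∀ i, xMarginal β i ≠ 0 := fun i h0 => by
    -- a zero coefficient matrix would contradict the floor `30 ≤ R`
    have hr : 30 ≤ tensorRank (matMulTensor (ZMod 3) 2 2 9) := by
      have h := (tensorRank_matMulTensor_22n_gf3_window 9 (by norm_num)).1
      have h' : max (3 * 9 + 2) ((36 * 9 + 10) / 11) = 30 := by norm_num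
      omega
    exact xMarginal_ne_zero_of_le_tensorRank hr β i h0
  -- the moved representative has the count vector of the marginal
  have hM0 := moveW_ne_zero w hw (REP930 j) hR0
  have hcnt : Eq40 (cnt (moveW w (REP930 j))) (cnt (xMarginal β)) := fun b hb => by
    rw [cnt_moveW w hw (REP930 j) b hb, actWS_congr w hw hRc b hb, ← he b hb]
  have horb : InOrbit (xMarginal β) (REP930 j) :=
    ((inOrbit_moveW w hw (REP930 j)).trans (inOrbit_of_cnt_eq _ _ hM0 hm hcnt)).symm
  obtain ⟨β', hβ'⟩ := exists_xMarginal_eq_of_inOrbit β horb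
  exact xMarginal_ne_REP930 j hj β' hβ'

/-- **`R_𝔽₃(⟨2,2,9⟩) ∈ [31, 32]`** (ceiling: Hopcroft–Kerr `⌊(7·9+1)/2⌋ = 32`). -/
theorem tensorRank_229_gf3_mem : tensorRank (matMulTensor (ZMod 3) 2 2 9) ∈ Set.Icc 31 32 :=
  ⟨thirtyone_le_tensorRank_229_gf3, hopcroftKerr1971_tensorRank_matMulTensor_22n_le (K := ZMod 3) 9⟩

end Summit.MatrixMultiplication.OmegaCensus.SmallFormats.Cover930
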